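import Summits.Ventures.Crystal3D.Theorems.StickyWulffConstantGenericWallFloorBarlowFamiliesApart
import Summits.Ventures.Crystal3D.Theorems.StickyWulffConstantGenericWallFloorBarlowWindowTiltRef
import Summits.Ventures.Crystal3D.Theorems.StickyWulffConstantGenericWallFloorBarlowCoreAvoidTilt
import HarnessLib

/-!
# The STEERED top zigzag window family, frames apart from the bottom plate: `topFamily_spec_apart_tilt`
# (K1b / EDGE-ON option (ε), brick 4-top; lane T crux `TextureLiminfV5`, stmt-Ventures-23912, sub-crux EDGE-ON `stub_edgeOn`; HOME/wall-p2-g11/EPSILON-SIZING.md)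

HONEST FRAMING. Venture `Summits/Ventures/Crystal3D` (cell `crystal3d-full`), route `route-Ventures-StickyWulffConstant`, helper `--supports` the
law-v5 crux `TextureLiminfV5` (stmt-Ventures-23912), registered line `TexShadow` v8.3, open stub `stub_edgeOn` (K4).  Rung credit only; F-C1 not moved; NOT
the stub.  Pure walk bookkeeping, standard axioms; E1 BY NAME (`hsE/hcert`).

Tilt port of `topFamily_spec_apart` (…BarlowFamiliesApart): the plate-2 zigzag window family walks with a unit steering `z` within `1/4` of `−e₃`, launch slot
steep FOR `z`, `∇`-cappers `bestCapper G (L₂ e₃) z`, chain frames `chainFrames z L₂ v₀` apart from plate 1's two lattices; the window, the complete region and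
the payer window stay in `−e₃`-heights (in-plate steps rising `≥ δ` toward `−e₃`).  Bricks: `canon_start_valid` (z-general), `windowFamily_walkRun_injOn_tiltRef` /
`windowStart_end_refHeight_gt` (…BarlowWindowTiltRef, `e = −e₃`), `walkEnd_not_low_apart_tilt` (…BarlowCoreAvoidTilt; lateral budget `8(h + 4R₀)`, fuel
`8(2R₀ + s.1₂) < N`).
* **`topFamily_spec_apart_tilt`** — validity, bottom entry, certified top, end in lane T's payer window, end-injectivity (no `z`-height fuel clause: the count adds it).
WHAT THIS IS NOT: not the count / lines / glue; F-C1 not moved.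
-/

noncomputable section

namespace Summit.Ventures.Crystal3D.Theorems

open Finset
open Literature.MathematicalPhysics.StatisticalMechanics
open Summit.Ventures.Crystal3D.Cruxes.TextureLiminf.TexShadow (stacking)
open scoped InnerProductSpace

variable {X : Finset (EuclideanSpace ℝ (Fin 3))}

section CellTop

variable (σ₂ : ℤ → ℤ) (L₂ : EuclideanSpace ℝ (Fin 3) ≃ₗᵢ[ℝ] EuclideanSpace ℝ (Fin 3)) (s₂ v₀ : EuclideanSpace ℝ (Fin 3))
  (canon : ℤ → EuclideanSpace ℝ (Fin 3) → EuclideanSpace ℝ (Fin 3) × List WalkEntry) (ms : ℤ → EuclideanSpace ℝ (Fin 3))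

open scoped Classical in
/-- **The STEERED top family (steering `z`, ‖z + e₃‖ ≤ 1/4), frames apart from the bottom plate, delivers the inputs of the frame-separated count**
(tilt port of `topFamily_spec_apart`: window in `−e₃`-heights, walk along `z`; the `z`-height fuel clause is left to the count file). -/
theorem topFamily_spec_apart_tilt (hσ₂ : IsHaggSeq σ₂) (hX : ∀ p ∈ X, ∀ q ∈ X, p ≠ q → 1 ≤ dist p q)
    {sE : EuclideanSpace ℝ (Fin 3)} (hsE : sE ∈ fccSlots) (hcert : ExactOnly 0 (fccSlots.filter fun w => 0 < ⟪w, sE⟫_ℝ))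
    -- the cell
    {σ₁ : ℤ → ℤ} (hσ₁ : IsHaggSeq σ₁) (L₁ : EuclideanSpace ℝ (Fin 3) ≃ₗᵢ[ℝ] EuclideanSpace ℝ (Fin 3)) (s₀ : EuclideanSpace ℝ (Fin 3))
    (R₀ h ρ : ℝ) (hR₀ : 6 ≤ R₀) (hh : 0 ≤ h) (hρ : 1 ≤ ρ) (P₁ P₂ : Finset (EuclideanSpace ℝ (Fin 3))) (hP₁X : P₁ ⊆ X) (hP₂X : P₂ ⊆ X)
    (hcell : ∀ p ∈ X, -(2 * R₀) ≤ p 2 ∧ p 2 ≤ h + 2 * R₀ ∧ p 0 ^ 2 + p 1 ^ 2 ≤ ρ ^ 2)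
    (hP₁ : ∀ p, p ∈ P₁ ↔ (p ∈ stacking L₁ s₀ σ₁ ∧ -(2 * R₀) ≤ p 2 ∧ p 2 ≤ -R₀ ∧ p 0 ^ 2 + p 1 ^ 2 ≤ ρ ^ 2))
    (hP₂ : ∀ p, p ∈ P₂ ↔ (p ∈ stacking L₂ s₂ σ₂ ∧ h + R₀ ≤ p 2 ∧ p 2 ≤ h + 2 * R₀ ∧ p 0 ^ 2 + p 1 ^ 2 ≤ ρ ^ 2))
    -- the steering and the walk data (window heights along −e₃)
    {z : EuclideanSpace ℝ (Fin 3)} (hz : ‖z‖ = 1) (hze : ‖z - (-EuclideanSpace.single (2 : Fin 3) (1 : ℝ))‖ ≤ 1 / 4)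
    (hv₀ : v₀ ∈ fccSlots) (hv₀2 : v₀ 2 = Real.sqrt (2 / 3))
    (hsteep : Real.sqrt 2 / 2 ≤ ⟪L₂ v₀, z⟫_ℝ)
    (hcanon₁ : ∀ m t, σ₂ (m - 1) = 1 → canon m t = (t, [⟨L₂, v₀, 0⟩]))
    (hcanon₂ : ∀ m t, σ₂ (m - 1) = -1 → canon m t =
      (t, [⟨twinFrame L₂ (L₂ (EuclideanSpace.single (2 : Fin 3) (1 : ℝ))),
            bestCapper (twinFrame L₂ (L₂ (EuclideanSpace.single (2 : Fin 3) (1 : ℝ)))) (L₂ (EuclideanSpace.single (2 : Fin 3) (1 : ℝ))) z,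
            L₂ (EuclideanSpace.single (2 : Fin 3) (1 : ℝ))⟩, ⟨L₂, v₀, 0⟩]))
    (hms₁ : ∀ m, σ₂ m = 1 → ms m = v₀)
    (hms₂ : ∀ m, σ₂ m = -1 → ms m =
      basalMirror (bestCapper (twinFrame L₂ (L₂ (EuclideanSpace.single (2 : Fin 3) (1 : ℝ)))) (L₂ (EuclideanSpace.single (2 : Fin 3) (1 : ℝ))) z))
    {δ : ℝ} (hδ0 : 0 < δ) (hδ : ∀ m, δ ≤ ⟪L₂ (ms m), -EuclideanSpace.single (2 : Fin 3) (1 : ℝ)⟫_ℝ)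
    -- off-registry
    (hapart : ∀ F ∈ chainFrames z L₂ v₀,
      F '' fccStacking 1 (Real.sqrt (2 / 3)) ≠ L₁ '' fccStacking 1 (Real.sqrt (2 / 3)) ∧
      F '' fccStacking 1 (Real.sqrt (2 / 3)) ≠
        (twinFrame L₁ (L₁ (EuclideanSpace.single (2 : Fin 3) (1 : ℝ)))) '' fccStacking 1 (Real.sqrt (2 / 3)))
    -- the family (heights along −e₃)
    (H ρin : ℝ) (hHlo : -(h + 2 * R₀) + 2 ≤ H) (hHhi : H ≤ -(h + R₀) - 3)
    (hρin : ρin + 8 * (h + 4 * R₀) + ((-(h + R₀) - 2 - H) / δ + 2) ≤ ρ - 1)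
    {ι : Type*} (T : Finset ι) (mi ai bi : ι → ℤ)
    (hlow : ∀ i ∈ T, H ≤ ⟪L₂ (barlowPos 1 (Real.sqrt (2 / 3)) σ₂ (mi i) (ai i) (bi i)) + s₂, -EuclideanSpace.single (2 : Fin 3) (1 : ℝ)⟫_ℝ)
    (hpred : ∀ i ∈ T, ⟪L₂ (barlowPos 1 (Real.sqrt (2 / 3)) σ₂ (mi i) (ai i) (bi i) - ms (mi i - 1)) + s₂,
      -EuclideanSpace.single (2 : Fin 3) (1 : ℝ)⟫_ℝ < H)
    (hinjT : ∀ i ∈ T, ∀ j ∈ T,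
      barlowPos 1 (Real.sqrt (2 / 3)) σ₂ (mi i) (ai i) (bi i) = barlowPos 1 (Real.sqrt (2 / 3)) σ₂ (mi j) (ai j) (bi j) → i = j)
    (hlat : ∀ i ∈ T, Real.sqrt ((L₂ (barlowPos 1 (Real.sqrt (2 / 3)) σ₂ (mi i) (ai i) (bi i)) + s₂) 0 ^ 2 +
      (L₂ (barlowPos 1 (Real.sqrt (2 / 3)) σ₂ (mi i) (ai i) (bi i)) + s₂) 1 ^ 2) ≤ ρin)
    -- fuel
    {N : ℕ} (hN1 : ⌈(-(h + R₀) - 2 - H) / δ⌉₊ + 1 ≤ N) (hN2 : 8 * (h + 4 * R₀) < (N : ℝ)) :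
    (∀ i ∈ T,
      WalkInv X z (canon (mi i) (L₂ (barlowPos 1 (Real.sqrt (2 / 3)) σ₂ (mi i) (ai i) (bi i)) + s₂)) ∧
      StackWF z (canon (mi i) (L₂ (barlowPos 1 (Real.sqrt (2 / 3)) σ₂ (mi i) (ai i) (bi i)) + s₂)).2 ∧
      (canon (mi i) (L₂ (barlowPos 1 (Real.sqrt (2 / 3)) σ₂ (mi i) (ai i) (bi i)) + s₂)).2.getLast? = some ⟨L₂, v₀, 0⟩ ∧
      (∃ e rest, (canon (mi i) (L₂ (barlowPos 1 (Real.sqrt (2 / 3)) σ₂ (mi i) (ai i) (bi i)) + s₂)).2 = e :: rest ∧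
        WalkCertified12 X (canon (mi i) (L₂ (barlowPos 1 (Real.sqrt (2 / 3)) σ₂ (mi i) (ai i) (bi i)) + s₂)).1 e) ∧
      (walkRun X z N
          (canon (mi i) (L₂ (barlowPos 1 (Real.sqrt (2 / 3)) σ₂ (mi i) (ai i) (bi i)) + s₂))).1 ∈
        X.filter (fun y => (X.filter fun q => dist y q = 1).card ≠ 12 ∧ -R₀ - 2 ≤ y 2 ∧ y 2 ≤ h + R₀ + 2)) ∧
    (∀ i ∈ T, ∀ j ∈ T,
      walkRun X z N (canon (mi i) (L₂ (barlowPos 1 (Real.sqrt (2 / 3)) σ₂ (mi i) (ai i) (bi i)) + s₂)) =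
        walkRun X z N (canon (mi j) (L₂ (barlowPos 1 (Real.sqrt (2 / 3)) σ₂ (mi j) (ai j) (bi j)) + s₂)) →
      i = j) := by
  set zt : EuclideanSpace ℝ (Fin 3) := -EuclideanSpace.single (2 : Fin 3) (1 : ℝ) with hzt
  have hztn : ‖zt‖ = 1 := by rw [hzt, norm_neg, PiLp.norm_single, norm_one]
  have hzti : ∀ d : EuclideanSpace ℝ (Fin 3), ⟪d, zt⟫_ℝ = -d 2 := fun d => by
    rw [hzt, inner_neg_right, EuclideanSpace.inner_single_right]; simp
  set bp : ℤ → ℤ → ℤ → EuclideanSpace ℝ (Fin 3) := fun m a b => barlowPos 1 (Real.sqrt (2 / 3)) σ₂ m a b with hbp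
  set Ztop : ℝ := -(h + R₀) - 2 with hZtop
  set D : ℝ := (Ztop - H) / δ + 1 with hD
  have hDdef : D = (-(h + R₀) - 2 - H) / δ + 1 := by rw [hD, hZtop]
  have hD0 : 0 ≤ D := by rw [hDdef]; have : 0 ≤ (-(h + R₀) - 2 - H) / δ := div_nonneg (by linarith) hδ0.le; linarith
  -- the deep region of the top plate and its two properties
  set R : Set (EuclideanSpace ℝ (Fin 3)) := {p | h + R₀ + 1 ≤ (L₂ p + s₂) 2 ∧ (L₂ p + s₂) 2 ≤ h + 2 * R₀ - 1 ∧
    (L₂ p + s₂) 0 ^ 2 + (L₂ p + s₂) 1 ^ 2 ≤ (ρ - 1) ^ 2} with hRdef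
  have hR : ∀ m i j : ℤ, bp m i j ∈ R → ∀ q ∈ barlowStacking 1 (Real.sqrt (2 / 3)) σ₂, dist q (bp m i j) ≤ 1 → L₂ q + s₂ ∈ X :=
    fun m i j hm => barlowWindow_complete_gen L₂ s₂ (h + R₀) (h + 2 * R₀) ρ hρ P₂ hP₂X hP₂ m i j hm.1 (by linarith [hm.2.1]) hm.2.2
  have hRin : ∀ i ∈ T, ∀ m a b : ℤ, H ≤ ⟪L₂ (bp m a b) + s₂, zt⟫_ℝ → ⟪L₂ (bp m a b) + s₂, zt⟫_ℝ ≤ Ztop →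
      ‖bp m a b - bp (mi i) (ai i) (bi i)‖ ≤ (Ztop - H) / δ + 1 → bp m a b ∈ R := by
    intro i hi m a b h1 h2 h3
    rw [hzti] at h1 h2
    refine ⟨by rw [hZtop] at h2; linarith, by linarith, ?_⟩
    have hd : dist (L₂ (bp m a b) + s₂) (L₂ (bp (mi i) (ai i) (bi i)) + s₂) ≤ D := by
      rw [dist_eq_norm, show L₂ (bp m a b) + s₂ - (L₂ (bp (mi i) (ai i) (bi i)) + s₂) = L₂ (bp m a b) - L₂ (bp (mi i) (ai i) (bi i)) by abel,
        ← map_sub, LinearIsometryEquiv.norm_map, hD]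
      exact h3
    have hr := lateral_radius_le_add_dist (L₂ (bp m a b) + s₂) (L₂ (bp (mi i) (ai i) (bi i)) + s₂)
    have hr' : Real.sqrt ((L₂ (bp m a b) + s₂) 0 ^ 2 + (L₂ (bp m a b) + s₂) 1 ^ 2) ≤ ρ - 1 := by
      have := hlat i hi; rw [hDdef] at hd; nlinarith [hρin, hh, hR₀]
    have h0 : 0 ≤ (L₂ (bp m a b) + s₂) 0 ^ 2 + (L₂ (bp m a b) + s₂) 1 ^ 2 := by positivity
    have h7 := pow_le_pow_left₀ (Real.sqrt_nonneg _) hr' 2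
    rwa [Real.sq_sqrt h0] at h7
  -- positions / bottom entries of canonical states; unit steps
  have hpos : ∀ m t, (canon m t).1 = t := by
    intro m t
    rcases hσ₂ (m - 1) with hm | hm
    · rw [hcanon₁ m t hm]
    · rw [hcanon₂ m t hm]
  have hlast : ∀ m t, (canon m t).2.getLast? = some ⟨L₂, v₀, 0⟩ := by
    intro m t
    rcases hσ₂ (m - 1) with hm | hm
    · rw [hcanon₁ m t hm]; rfl
    · rw [hcanon₂ m t hm]; rfl
  have hms : ∀ m, ‖ms m‖ = 1 := by
    intro m
    rcases hσ₂ m with hm | hm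
    · rw [hms₁ m hm, norm_eq_one_of_mem_fccSlots hv₀]
    · rw [hms₂ m hm, LinearIsometryEquiv.norm_map, norm_eq_one_of_mem_fccSlots (bestCapper_nabla_slot L₂ z).1]
  -- validity of every start
  have hvalid : ∀ i ∈ T, WalkInv X z (canon (mi i) (L₂ (bp (mi i) (ai i) (bi i)) + s₂)) ∧
      StackWF z (canon (mi i) (L₂ (bp (mi i) (ai i) (bi i)) + s₂)).2 ∧
      ∃ e rest, (canon (mi i) (L₂ (bp (mi i) (ai i) (bi i)) + s₂)).2 = e :: rest ∧
        WalkCertified12 X (canon (mi i) (L₂ (bp (mi i) (ai i) (bi i)) + s₂)).1 e := by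
    intro i hi
    obtain ⟨a', b', hab⟩ := pred_mem_barlowLayer σ₂ hσ₂ L₂ z v₀ ms hv₀ hv₀2 hms₁ hms₂ (mi i) (ai i) (bi i)
    have hpredeq : bp (mi i - 1) a' b' + ms (mi i - 1) = bp (mi i) (ai i) (bi i) := by
      show barlowPos 1 (Real.sqrt (2 / 3)) σ₂ (mi i - 1) a' b' + ms (mi i - 1) = barlowPos 1 (Real.sqrt (2 / 3)) σ₂ (mi i) (ai i) (bi i)
      rw [← hab, sub_add_cancel]
    have hph : ⟪L₂ (bp (mi i - 1) a' b') + s₂, zt⟫_ℝ < H := by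
      have := hpred i hi; rw [hab] at this; exact this
    have hpl : H - 1 ≤ ⟪L₂ (bp (mi i - 1) a' b') + s₂, zt⟫_ℝ := by
      have h1 := height_step_le L₂ s₂ zt ms hztn hms (bp (mi i - 1) a' b') (mi i - 1)
      rw [hpredeq] at h1
      have h2 := hlow i hi
      linarith
    have hplat : Real.sqrt ((L₂ (bp (mi i - 1) a' b') + s₂) 0 ^ 2 + (L₂ (bp (mi i - 1) a' b') + s₂) 1 ^ 2) ≤ ρin + 1 := by
      have h1 := lateral_radius_le_add_dist (L₂ (bp (mi i - 1) a' b') + s₂) (L₂ (bp (mi i) (ai i) (bi i)) + s₂)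
      have h2 : dist (L₂ (bp (mi i - 1) a' b') + s₂) (L₂ (bp (mi i) (ai i) (bi i)) + s₂) ≤ 1 := by
        rw [dist_eq_norm, show L₂ (bp (mi i - 1) a' b') + s₂ - (L₂ (bp (mi i) (ai i) (bi i)) + s₂) =
          L₂ (bp (mi i - 1) a' b') - L₂ (bp (mi i) (ai i) (bi i)) by abel, ← map_sub, LinearIsometryEquiv.norm_map,
          ← hpredeq, show bp (mi i - 1) a' b' - (bp (mi i - 1) a' b' + ms (mi i - 1)) = -ms (mi i - 1) by abel, norm_neg, hms]
      have h3 := hlat i hi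
      linarith
    have hXpred : ∀ q ∈ barlowStacking 1 (Real.sqrt (2 / 3)) σ₂, dist q (bp (mi i - 1) a' b') ≤ 1 → L₂ q + s₂ ∈ X := by
      rw [hzti] at hph hpl
      refine hR (mi i - 1) a' b' ⟨?_, ?_, ?_⟩
      · linarith
      · linarith
      · have h0 : 0 ≤ (L₂ (bp (mi i - 1) a' b') + s₂) 0 ^ 2 + (L₂ (bp (mi i - 1) a' b') + s₂) 1 ^ 2 := by positivity
        have hr : Real.sqrt ((L₂ (bp (mi i - 1) a' b') + s₂) 0 ^ 2 + (L₂ (bp (mi i - 1) a' b') + s₂) 1 ^ 2) ≤ ρ - 1 := by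
          nlinarith [hplat, hρin, hD0, hh]
        have h7 := pow_le_pow_left₀ (Real.sqrt_nonneg _) hr 2
        rwa [Real.sq_sqrt h0] at h7
    have key := canon_start_valid (σ := σ₂) (L := L₂) (s₀ := s₂) (z := z) (v₀ := v₀) (canon := canon) (ms := ms)
      hσ₂ hz hv₀ hv₀2 hsteep hcanon₁ hcanon₂ hms₁ hms₂ (k := mi i - 1) (i := a') (j := b') hXpred
    have e1 : mi i - 1 + 1 = mi i := by ring
    rw [e1] at key
    have e2 : barlowPos 1 (Real.sqrt (2 / 3)) σ₂ (mi i - 1) a' b' + ms (mi i - 1) = bp (mi i) (ai i) (bi i) := hpredeq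
    rw [e2] at key
    exact key
  -- injectivity
  have hinj := windowFamily_walkRun_injOn_tiltRef (σ := σ₂) (L := L₂) (s₀ := s₂) (z := z) (v₀ := v₀) (ms := ms) (canon := canon)
    hσ₂ hX hsE hcert hztn hz hze hv₀ hv₀2 hcanon₁ hcanon₂ hms₁ hms₂ hδ0 hδ R hR H Ztop (by rw [hZtop]; linarith) T mi ai bi hRin hlow hpred
    hinjT (fun i hi => ⟨(hvalid i hi).1, (hvalid i hi).2.1⟩) N
  refine ⟨fun i hi => ?_, hinj⟩
  obtain ⟨hI, hW, hC⟩ := hvalid i hi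
  have hstart2 : -(h + 2 * R₀) ≤ ⟪(canon (mi i) (L₂ (bp (mi i) (ai i) (bi i)) + s₂)).1, zt⟫_ℝ := by
    rw [hzti]; linarith [(hcell _ hI.1).2.1]
  have hfuel : 8 * (2 * R₀ + (canon (mi i) (L₂ (bp (mi i) (ai i) (bi i)) + s₂)).1 2) < N := by
    rw [hzti] at hstart2; linarith
  -- below the window after the fuel (heights along −e₃)
  have hgt := windowStart_end_refHeight_gt (σ := σ₂) (L := L₂) (s₀ := s₂) (z := z) (v₀ := v₀) (canon := canon) (ms := ms)
    hσ₂ hX hsE hcert hz hze hv₀ hv₀2 hcanon₁ hcanon₂ hms₁ hms₂ hδ0 hδ R hR H Ztop (by rw [hZtop]; linarith) (mi i) (ai i) (bi i)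
    (hRin i hi) (hlow i hi) ⟨hI, hW⟩ (N := N) (by rw [hZtop]; exact hN1)
  have hhigh' : (walkRun X z N (canon (mi i) (L₂ (bp (mi i) (ai i) (bi i)) + s₂))).1 2 ≤ h + R₀ + 2 := by
    rw [hzti, hZtop] at hgt; linarith
  -- frames of the stacks, lateral margin, then «not low» by core avoidance
  have hM₂ : ∀ stk : List WalkEntry, StackSound z stk → StackWF z stk → stk.getLast? = some ⟨L₂, v₀, 0⟩ →
      ∀ e ∈ stk, e.frame ∈ chainFrames z L₂ v₀ := fun stk hS hWF hl => frame_mem_chainFrames_of_stack hS hWF hl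
  have hfrac : 0 ≤ (-(h + R₀) - 2 - H) / δ := div_nonneg (by linarith) hδ0.le
  have hlat' : Real.sqrt ((canon (mi i) (L₂ (bp (mi i) (ai i) (bi i)) + s₂)).1 0 ^ 2 +
      (canon (mi i) (L₂ (bp (mi i) (ai i) (bi i)) + s₂)).1 1 ^ 2) + 8 * (h + 4 * R₀) ≤ ρ - 2 := by
    rw [hpos]; have := hlat i hi; linarith
  have hρ2 : 2 ≤ ρ := by
    have h1 := hlat i hi
    have h2 := Real.sqrt_nonneg ((L₂ (bp (mi i) (ai i) (bi i)) + s₂) 0 ^ 2 + (L₂ (bp (mi i) (ai i) (bi i)) + s₂) 1 ^ 2)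
    linarith
  obtain ⟨hyX, hydeg, -, hnotlow⟩ := walkEnd_not_low_apart_tilt hX hsE hcert hσ₁ L₁ s₀ R₀ h ρ hρ2 P₁ hP₁X hcell hP₁
    (chainFrames z L₂ v₀) hz hze hM₂ hapart hI hW (hlast _ _) hlat' hfuel
  refine ⟨hI, hW, hlast _ _, hC, ?_⟩
  rw [Finset.mem_filter]
  exact ⟨hyX, Nat.ne_of_lt (Nat.lt_of_le_of_lt hydeg (by norm_num)), by linarith, hhigh'⟩

end CellTop

end Summit.Ventures.Crystal3D.Theorems

end
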